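import Mathlib
import Summits.ValiantsHypothesis.ValiantsHypothesis.Theorems.LiouvilleSarnakAlignedTypeICharactersMod2nBilinearSieve
import HarnessLib

/-!
# Route LiouvilleSarnak — support `AlignedTypeI` (stmt-ValiantsHypothesis-21040), line `characters_mod_2n`:
# the Turán–Kubilius variance of `ω_𝒫`, elementary form, and the parameter-free bilinear inequality

`charSqSum_mul_sq_le_of_blockBounds` (`…BilinearSieve.lean`) takes the variance `T ≥ Σ_{m ≤ x} (ω_𝒫(m) − L)²` as a parameter.
Here it is bounded elementarily (second moment from `sum_Ioc_card_filter_dvd_sq_le`, first moment `Σ_m ω_𝒫(m) = Σ_p ⌊x/p⌋ ≥ xL − |𝒫|`):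
`Σ_{m ≤ x} (ω_𝒫(m) − L)² ≤ xL + |𝒫|² + 2L|𝒫|` (`sum_Icc_omega_sub_sq_le`; the classical Turán–Kubilius bound is `≪ xL`, the extra
`|𝒫|²` is harmless for `|𝒫| ≤ x^{1/2−}`), whence the parameter-free inequality `charSqSum_mul_sq_le_of_blockBounds'`.
(Self-contained: avoids importing `Literature.NumberTheory.LFunctions.TuranKubilius`.)

HONEST FRAMING. Unconditional inequalities; the block bounds `β` remain the input. `AlignedTypeI` is NOT closed here;
nothing bears on `VP ≠ VNP` (NOT proved).
-/

set_option linter.dupNamespace false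

noncomputable section

namespace Summit.ValiantsHypothesis.ValiantsHypothesis.Theorems.LiouvilleSarnak.AlignedTypeI.CharactersModTwoN

open ArithmeticFunction Finset
open scoped BigOperators

/-- First moment of `ω_𝒫` on `[1, x]`: `Σ_{m ≤ x} #{p ∈ 𝒫 : p ∣ m} = Σ_{p ∈ 𝒫} ⌊x/p⌋ ≥ xL − |𝒫|`. [folklore] -/
theorem sum_Icc_omega_ge (x : ℕ) (P : Finset ℕ) (hP : ∀ p ∈ P, 0 < p) :
    (x : ℝ) * (∑ p ∈ P, (1 : ℝ) / p) - P.card ≤ ∑ m ∈ Finset.Icc 1 x, (((P.filter (fun p => p ∣ m)).card : ℝ)) := by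
  classical
  have h1 : ∀ m, (((P.filter (fun p => p ∣ m)).card : ℝ)) = ∑ p ∈ P.filter (fun p => p ∣ m), (1 : ℝ) := by
    intro m
    simp
  simp_rw [h1]
  rw [sum_Icc_sum_filter_dvd_eq P hP x (fun _ _ => (1 : ℝ))]
  simp only [Finset.sum_const, Nat.card_Icc, add_tsub_cancel_right, nsmul_eq_mul, mul_one]
  rw [Finset.mul_sum, Finset.card_eq_sum_ones, Nat.cast_sum, ← Finset.sum_sub_distrib]
  refine Finset.sum_le_sum fun p hp => ?_
  have hp0 := hP p hp
  have h := Nat.lt_div_mul_add hp0 (a := x)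
  have hpR : (0 : ℝ) < p := by exact_mod_cast hp0
  have h' : (x : ℝ) < ((x / p : ℕ) : ℝ) * p + p := by exact_mod_cast h
  have hgoal : (x : ℝ) / p - 1 ≤ ((x / p : ℕ) : ℝ) := by
    rw [div_sub_one hpR.ne', div_le_iff₀ hpR]
    linarith
  have heq : (x : ℝ) * (1 / (p : ℝ)) - ((1 : ℕ) : ℝ) = (x : ℝ) / p - 1 := by
    rw [mul_one_div, Nat.cast_one]
  rw [heq]
  exact hgoal

/-- **Variance of `ω_𝒫` on `[1, x]` (elementary Turán–Kubilius)**: for a finite set `𝒫` of primes and `L = Σ_{p ∈ 𝒫} 1/p`,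
`Σ_{m ≤ x} (#{p ∈ 𝒫 : p ∣ m} − L)² ≤ xL + |𝒫|² + 2L|𝒫|`. [folklore] -/
theorem sum_Icc_omega_sub_sq_le (x : ℕ) (P : Finset ℕ) (hP : ∀ p ∈ P, p.Prime) :
    ∑ m ∈ Finset.Icc 1 x, ((((P.filter (fun p => p ∣ m)).card : ℝ)) - ∑ p ∈ P, (1 : ℝ) / p) ^ 2 ≤
      (x : ℝ) * (∑ p ∈ P, (1 : ℝ) / p) + (P.card : ℝ) ^ 2 + 2 * (∑ p ∈ P, (1 : ℝ) / p) * P.card := by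
  classical
  set L := ∑ p ∈ P, (1 : ℝ) / p with hL
  set ω : ℕ → ℝ := fun m => (((P.filter (fun p => p ∣ m)).card : ℝ)) with hω
  have hL0 : 0 ≤ L := Finset.sum_nonneg fun p _ => by positivity
  have hIcc : Finset.Icc 1 x = Finset.Ioc 0 x := by
    ext m
    simp only [Finset.mem_Icc, Finset.mem_Ioc]
    omega
  -- second moment
  have h2 : ∑ m ∈ Finset.Icc 1 x, ω m ^ 2 ≤ (x : ℝ) * L ^ 2 + (x : ℝ) * L + (P.card : ℝ) ^ 2 := by
    have h := sum_Ioc_card_filter_dvd_sq_le P hP (Nat.zero_le x)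
    rw [← hIcc] at h
    simpa [hω, hL] using h
  -- first moment
  have h1 : (x : ℝ) * L - P.card ≤ ∑ m ∈ Finset.Icc 1 x, ω m :=
    sum_Icc_omega_ge x P fun p hp => (hP p hp).pos
  -- expand the square
  have hexp : ∑ m ∈ Finset.Icc 1 x, (ω m - L) ^ 2 =
      ∑ m ∈ Finset.Icc 1 x, ω m ^ 2 - 2 * L * ∑ m ∈ Finset.Icc 1 x, ω m + (x : ℝ) * L ^ 2 := by
    have : ∀ m, (ω m - L) ^ 2 = ω m ^ 2 - 2 * L * ω m + L ^ 2 := fun m => by ring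
    simp_rw [this, Finset.sum_add_distrib, Finset.sum_sub_distrib, ← Finset.mul_sum, Finset.sum_const, Nat.card_Icc,
      add_tsub_cancel_right, nsmul_eq_mul]
  have hω' : ∀ m, ((((P.filter (fun p => p ∣ m)).card : ℝ)) - L) ^ 2 = (ω m - L) ^ 2 := fun m => rfl
  simp_rw [hω']
  rw [hexp]
  nlinarith

/-- **The bilinear inequality, parameter-free** (the elementary variance plugged in): under the hypotheses of
`charSqSum_mul_sq_le_of_blockBounds`,
`L² Σ_{ψ ≠ 1} |Σ_{m ≤ x} λ(m)ψ(m)|² ≤ 3 (xR(xR + 2qR') + (ℓ + 2q)(ℓL² + ℓL + |𝒫|²) + (x + 2q)(xL + |𝒫|² + 2L|𝒫|))`. [folklore] -/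
theorem charSqSum_mul_sq_le_of_blockBounds' {q : ℕ} [NeZero q] (x ℓ : ℕ) (hℓx : ℓ ≤ x)
    (P : Finset ℕ) (hP : ∀ p ∈ P, p.Prime)
    (V : ℕ → ℕ) (hV : ∀ p ∈ P, p ≤ V p) (hVx : ∀ p ∈ P, V p ≤ x) (hVℓ : ∀ p ∈ P, x * V p ≤ x * p + ℓ * V p)
    (β : ℕ → ℝ) (hβ0 : ∀ v, 0 ≤ β v)
    (hβ : ∀ ψ : DirichletCharacter ℂ q, ψ ≠ 1 → ∀ v ∈ P.image V,
      ‖∑ p ∈ P.filter (fun p => V p = v), ψ (p : ZMod q)‖ ≤ β v) :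
    (∑ p ∈ P, (1 : ℝ) / p) ^ 2 *
        ∑ ψ ∈ (Finset.univ : Finset (DirichletCharacter ℂ q)).erase 1,
          ‖∑ m ∈ Finset.Icc 1 x, (liouville m : ℂ) * ψ (m : ZMod q)‖ ^ 2 ≤
      3 * ((x : ℝ) * (∑ v ∈ P.image V, β v / v) *
              ((x : ℝ) * (∑ v ∈ P.image V, β v / v) + 2 * q * ∑ v ∈ P.image V, β v) +
            ((ℓ : ℝ) + 2 * q) * ((ℓ : ℝ) * (∑ p ∈ P, (1 : ℝ) / p) ^ 2 + (ℓ : ℝ) * (∑ p ∈ P, (1 : ℝ) / p)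
              + (P.card : ℝ) ^ 2) +
            ((x : ℝ) + 2 * q) * ((x : ℝ) * (∑ p ∈ P, (1 : ℝ) / p) + (P.card : ℝ) ^ 2 +
              2 * (∑ p ∈ P, (1 : ℝ) / p) * P.card)) :=
  charSqSum_mul_sq_le_of_blockBounds x ℓ hℓx P hP V hV hVx hVℓ β hβ0 hβ _ (sum_Icc_omega_sub_sq_le x P hP)

end Summit.ValiantsHypothesis.ValiantsHypothesis.Theorems.LiouvilleSarnak.AlignedTypeI.CharactersModTwoN
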